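import Mathlib
import HarnessLib
import Summits.KontsevichZagierPeriods.KontsevichZagierPeriods.Theses.HermiteRigidity
import Literature.NumberTheory.Transcendental.KZLogCalculusProofs
import Literature.NumberTheory.Transcendental.KZRelationsLE

/-!
# Sketch — crux-ideate round 1, ideator 1, crux `EllipticMomentKernel` (stmt-KontsevichZagierPeriods-10631)

Route `HermiteRigidity`, crux decl
`Summit.KontsevichZagierPeriods.KontsevichZagierPeriods.Theses.HermiteRigidity.EllipticMomentKernel`.

* Shared data of the crux as named abbreviations (`cubic`, `oval` = σ, `underGraph` = D, `gens` = S,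
  `Rigid` = the inlined rigidity hypothesis) and `crux_iff` (PROVED, `Iff.rfl`): the crux is literally
  `∀ q₂ q₃, Δ > 0 → Rigid → kernel(gens) ⊆ relations`.
* `hermiteOp` — the Hermite operator `D(P) = P′f + P f′/2` on `ℚ[X]`; `hermiteDecomposition`
  (`ℚ[X] = ℚ ⊕ ℚ·X + D(ℚ[X])`, pure algebra — PROVED, strong induction on the exponent).
* Card `hermite-coordinates-hom`: `kernel_of_coordinates` (PROVED — the whole composition of the line:
  coordinates `χ`, normal forms `ν`, value functional `ℓ` as additive homomorphisms; the crux is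
  "two homomorphisms agree on generators" + rigidity), and the first checkable statement of the line,
  `stub_reduceOneDim` (generator reduction = Hermite coordinates + one exact form).
* Card `merge-first-single-hermite`: first lemma `stub_mergeToPair` (rule 1b merging on the two common
  domains, integrability inherited from the generators) and `stub_columnMove` (ONE Newton–Leibniz move
  along `y` for the merged 2-dimensional part).
-/

noncomputable section

open MeasureTheory Set
open scoped Polynomial

namespace Summit.KontsevichZagierPeriods.KontsevichZagierPeriods.Cruxes.EllipticMomentKernel.Ideate1

open Literature.NumberTheory.Transcendental

/-! ## The data of the crux -/

/-- The cubic `f(x) = 4x³ − q₂x − q₃`. -/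
def cubic (q₂ q₃ : ℚ) (x : ℝ) : ℝ := 4 * x ^ 3 - (q₂ : ℝ) * x - (q₃ : ℝ)

/-- `σ = (e₃, e₂)`, the bounded component of `{f > 0}` (verbatim the crux's `σ`). -/
def oval (q₂ q₃ : ℚ) : Set (Fin 1 → ℝ) :=
  {p | 0 < cubic q₂ q₃ (p 0) ∧ ∃ t : ℝ, p 0 < t ∧ cubic q₂ q₃ t < 0}

/-- `D = {x ∈ σ, 0 < y, y² < f x}`, the region under the graph of `√f` over `σ` (verbatim the crux's `D`). -/
def underGraph (q₂ q₃ : ℚ) : Set (Fin 2 → ℝ) :=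
  {p | (0 < cubic q₂ q₃ (p 0) ∧ ∃ t : ℝ, p 0 < t ∧ cubic q₂ q₃ t < 0) ∧ 0 < p 1 ∧ p 1 ^ 2 < cubic q₂ q₃ (p 0)}

/-- The generating set `S` of the elliptic moment sector (verbatim the crux's `S`). -/
def gens (q₂ q₃ : ℚ) : Set KZ.FormalRep :=
  {c | ∃ (r : KZ.IntegralRep 2) (a b : ℕ), r.domain = underGraph q₂ q₃ ∧
      EqOn r.integrand (fun p => p 0 ^ a * p 1 ^ b) (underGraph q₂ q₃) ∧ c = KZ.of r} ∪
  {c | ∃ (r : KZ.IntegralRep 1) (m : ℕ), r.domain = oval q₂ q₃ ∧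
      EqOn r.integrand (fun p => p 0 ^ m / Real.sqrt (cubic q₂ q₃ (p 0))) (oval q₂ q₃) ∧ c = KZ.of r}

/-- The inlined rigidity hypothesis: `1, J₀, J₁` are linearly independent over the real algebraic numbers. -/
def Rigid (q₂ q₃ : ℚ) : Prop :=
  ∀ a b c : ℝ, IsAlgebraic ℚ a → IsAlgebraic ℚ b → IsAlgebraic ℚ c →
    a + b * (∫ p in oval q₂ q₃, 1 / Real.sqrt (cubic q₂ q₃ (p 0))) +
      c * (∫ p in oval q₂ q₃, p 0 / Real.sqrt (cubic q₂ q₃ (p 0))) = 0 → a = 0 ∧ b = 0 ∧ c = 0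

/-- The crux, unfolded through the abbreviations above (definitional). -/
theorem crux_iff :
    Summit.KontsevichZagierPeriods.KontsevichZagierPeriods.Theses.HermiteRigidity.EllipticMomentKernel ↔
      ∀ q₂ q₃ : ℚ, 0 < (q₂ : ℝ) ^ 3 - 27 * (q₃ : ℝ) ^ 2 → Rigid q₂ q₃ →
        ∀ c ∈ AddSubgroup.closure (gens q₂ q₃), KZ.eval c = 0 → c ∈ KZ.relations :=
  Iff.rfl

/-! ## Hermite's operator on `ℚ[X]` -/

/-- The Hermite operator of the cubic: `D(P) = P′·f + P·f′/2`, so that `d(P√f) = D(P) dx/√f`. -/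
def hermiteOp (q₂ q₃ : ℚ) (P : ℚ[X]) : ℚ[X] :=
  Polynomial.derivative P * (4 * Polynomial.X ^ 3 - Polynomial.C q₂ * Polynomial.X - Polynomial.C q₃) +
    P * (Polynomial.C (1 / 2 : ℚ) * (12 * Polynomial.X ^ 2 - Polynomial.C q₂))

/-- `D` is `ℚ`-linear. -/
theorem hermiteOp_add (q₂ q₃ : ℚ) (P Q : ℚ[X]) :
    hermiteOp q₂ q₃ (P + Q) = hermiteOp q₂ q₃ P + hermiteOp q₂ q₃ Q := by
  simp only [hermiteOp, Polynomial.derivative_add]; ring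

/-- `D` as a `ℚ`-linear map. -/
def hermiteOpₗ (q₂ q₃ : ℚ) : ℚ[X] →ₗ[ℚ] ℚ[X] where
  toFun := hermiteOp q₂ q₃
  map_add' := hermiteOp_add q₂ q₃
  map_smul' := by
    intro c P
    simp only [hermiteOp, Polynomial.derivative_smul, smul_mul_assoc, smul_add, RingHom.id_apply]

@[simp] theorem hermiteOpₗ_apply (q₂ q₃ : ℚ) (P : ℚ[X]) : hermiteOpₗ q₂ q₃ P = hermiteOp q₂ q₃ P := rfl

/-- `D(1) = f′/2 = 6X² − q₂/2`, in the form `X² = (1/6)·(D(1) + q₂/2)`. -/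
theorem X_sq_eq (q₂ q₃ : ℚ) :
    (Polynomial.X : ℚ[X]) ^ 2 =
      (1 / 6 : ℚ) • (hermiteOp q₂ q₃ 1 + (q₂ / 2 : ℚ) • (1 : ℚ[X])) := by
  apply Polynomial.funext
  intro x
  simp [hermiteOp]
  ring

/-- The triangular recurrence: `D(X^{d+1}) = (4d+10)X^{d+3} − (d+3/2)q₂X^{d+1} − (d+1)q₃X^d`, in the
form `X^{d+3} = (4d+10)⁻¹·(D(X^{d+1}) + (d+3/2)q₂·X^{d+1} + (d+1)q₃·X^d)` (pivot `4d+10 ≠ 0`). -/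
theorem X_pow_add_three_eq (q₂ q₃ : ℚ) (d : ℕ) :
    (Polynomial.X : ℚ[X]) ^ (d + 3) = (1 / (4 * (d : ℚ) + 10)) •
      (hermiteOp q₂ q₃ (Polynomial.X ^ (d + 1)) + (((d : ℚ) + 3 / 2) * q₂) • Polynomial.X ^ (d + 1) +
        (((d : ℚ) + 1) * q₃) • Polynomial.X ^ d) := by
  have hd : (4 * (d : ℚ) + 10) ≠ 0 := by positivity
  apply Polynomial.funext
  intro x
  simp [hermiteOp]
  field_simp
  ring

/-- Every monomial lies in `ℚ·1 + ℚ·X + D(ℚ[X])` (strong induction on the exponent). -/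
theorem X_pow_mem (q₂ q₃ : ℚ) (m : ℕ) :
    (Polynomial.X : ℚ[X]) ^ m ∈
      Submodule.span ℚ {(1 : ℚ[X]), Polynomial.X} ⊔ LinearMap.range (hermiteOpₗ q₂ q₃) := by
  set M := Submodule.span ℚ {(1 : ℚ[X]), Polynomial.X} ⊔ LinearMap.range (hermiteOpₗ q₂ q₃) with hM
  have h1 : (1 : ℚ[X]) ∈ M := Submodule.mem_sup_left (Submodule.subset_span (by simp))
  have hX : (Polynomial.X : ℚ[X]) ∈ M := Submodule.mem_sup_left (Submodule.subset_span (by simp))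
  have hD : ∀ P, hermiteOp q₂ q₃ P ∈ M := fun P => Submodule.mem_sup_right ⟨P, rfl⟩
  induction m using Nat.strong_induction_on with
  | _ m ih =>
    match m with
    | 0 => simpa using h1
    | 1 => simpa using hX
    | 2 =>
      rw [X_sq_eq q₂ q₃]
      exact M.smul_mem _ (M.add_mem (hD 1) (M.smul_mem _ h1))
    | d + 3 =>
      rw [X_pow_add_three_eq q₂ q₃ d]
      exact M.smul_mem _ (M.add_mem (M.add_mem (hD _) (M.smul_mem _ (ih (d + 1) (by omega))))
        (M.smul_mem _ (ih d (by omega))))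

/-- Hence all of `ℚ[X]` does. -/
theorem mem_span_sup_range (q₂ q₃ : ℚ) (Q : ℚ[X]) :
    Q ∈ Submodule.span ℚ {(1 : ℚ[X]), Polynomial.X} ⊔ LinearMap.range (hermiteOpₗ q₂ q₃) := by
  induction Q using Polynomial.induction_on' with
  | add p q hp hq => exact Submodule.add_mem _ hp hq
  | monomial n a =>
    rw [← Polynomial.C_mul_X_pow_eq_monomial, ← Polynomial.smul_eq_C_mul]
    exact Submodule.smul_mem _ a (X_pow_mem q₂ q₃ n)

/-- **Hermite decomposition (PROVED; pure algebra, shared by every line):**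
`ℚ[X] = ℚ ⊕ ℚ·X + D(ℚ[X])` — every `Q ∈ ℚ[X]` is `α + βX + D(P)`. `D(X^{d+1})` has degree exactly
`d + 3` with pivot `4d + 10 ≠ 0` (`X_pow_add_three_eq`), so a strong induction on the exponent peels the
top monomial; no hypothesis on `q₂, q₃`.
[BostanLairezSalvy2013 §1 (Hermite reduction); Lawden1989 §6.13 (the recurrence for `∫ xᵐ dx/√f`)] -/
theorem hermiteDecomposition (q₂ q₃ : ℚ) (Q : ℚ[X]) :
    ∃ (α β : ℚ) (P : ℚ[X]), Q = Polynomial.C α + Polynomial.C β * Polynomial.X + hermiteOp q₂ q₃ P := by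
  have h := mem_span_sup_range q₂ q₃ Q
  rw [Submodule.mem_sup] at h
  obtain ⟨y, hy, z, hz, hyz⟩ := h
  rw [Submodule.mem_span_pair] at hy
  obtain ⟨α, β, rfl⟩ := hy
  obtain ⟨P, rfl⟩ := hz
  refine ⟨α, β, P, ?_⟩
  rw [← hyz, hermiteOpₗ_apply, Polynomial.smul_eq_C_mul, Polynomial.smul_eq_C_mul, mul_one]

/-! ## Card `hermite-coordinates-hom` -/

/-- **The composition of the line, PROVED.** Let `S` be any generating set, `χ : FormalRep →+ G` a
"coordinate" homomorphism (universal property of the free abelian group: `FreeAbelianGroup.lift` of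
the Hermite coordinates of generators), `ν : G →+ FormalRep ⧸ relations` a "normal form" homomorphism
(additive because rescaled copies on a common domain merge by rule 1b) and `ℓ : G →+ ℝ` the value
functional (`(A, α, β) ↦ A + αJ₀ + βJ₁`). If (i) every generator is congruent to the normal form of
its coordinates, (ii) `χ` computes values of generators, and (iii) RIGIDITY: on coordinates of elements
of the sector, `ℓ = 0` forces the normal form to vanish — then the kernel of `eval` on `closure S`
lies in `relations`. Both (i) and (ii) propagate from `S` to `closure S` because they are equalities
of additive maps; no normal-form subgroup, no signed-family cancellation, no finsets. -/
theorem kernel_of_coordinates {G : Type*} [AddCommGroup G] (S : Set KZ.FormalRep)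
    (χ : KZ.FormalRep →+ G) (ν : G →+ KZ.FormalRep ⧸ KZ.relations) (ℓ : G →+ ℝ)
    (hgen : ∀ x ∈ S, (QuotientAddGroup.mk x : KZ.FormalRep ⧸ KZ.relations) = ν (χ x))
    (hval : ∀ x ∈ S, KZ.eval x = ℓ (χ x))
    (hrig : ∀ c ∈ AddSubgroup.closure S, ℓ (χ c) = 0 → ν (χ c) = 0) :
    ∀ c ∈ AddSubgroup.closure S, KZ.eval c = 0 → c ∈ KZ.relations := by
  intro c hc h0
  have h1 : ∀ x ∈ AddSubgroup.closure S,
      (QuotientAddGroup.mk x : KZ.FormalRep ⧸ KZ.relations) = ν (χ x) := by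
    intro x hx
    induction hx using AddSubgroup.closure_induction with
    | mem y hy => exact hgen y hy
    | zero => simp
    | add y z _ _ hy hz => simp [hy, hz]
    | neg y _ hy => simp [hy]
  have h2 : ∀ x ∈ AddSubgroup.closure S, KZ.eval x = ℓ (χ x) := by
    intro x hx
    induction hx using AddSubgroup.closure_induction with
    | mem y hy => exact hval y hy
    | zero => simp
    | add y z _ _ hy hz => simp [hy, hz]
    | neg y _ hy => simp [hy]
  have h3 : ν (χ c) = 0 := hrig c hc (by rw [← h2 c hc]; exact h0)
  have h4 : (QuotientAddGroup.mk c : KZ.FormalRep ⧸ KZ.relations) = 0 := (h1 c hc).trans h3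
  exact (QuotientAddGroup.eq_zero_iff c).mp h4

/-- The shape in which rigidity (iii) is discharged from the crux's INLINED hypothesis `Rigid`:
coordinates `G = ℝ × ℚ × ℚ` (algebraic constant, coefficient of `dx/√f`, coefficient of `x dx/√f`),
value functional `ℓ (A, α, β) = A + α J₀ + β J₁`; on the coordinates of the sector the first entry is
real algebraic (it is `∫_σ` of a `ℚ`-polynomial, an element of `ℚ(e₂, e₃)`), so `Rigid` gives
`(A, α, β) = 0`. PROVED (bookkeeping only). -/
theorem rigid_coordinates (q₂ q₃ : ℚ) (hR : Rigid q₂ q₃) (A : ℝ) (α β : ℚ) (hA : IsAlgebraic ℚ A)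
    (h : A + (α : ℝ) * (∫ p in oval q₂ q₃, 1 / Real.sqrt (cubic q₂ q₃ (p 0))) +
      (β : ℝ) * (∫ p in oval q₂ q₃, p 0 / Real.sqrt (cubic q₂ q₃ (p 0))) = 0) :
    A = 0 ∧ α = 0 ∧ β = 0 := by
  obtain ⟨h₁, h₂, h₃⟩ := hR A α β hA (isAlgebraic_algebraMap (R := ℚ) (A := ℝ) α)
    (isAlgebraic_algebraMap (R := ℚ) (A := ℝ) β) (by simpa using h)
  exact ⟨h₁, by exact_mod_cast h₂, by exact_mod_cast h₃⟩

/-- **First checkable statement of the line `hermite-coordinates-hom`** (stub): generator reduction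
for the 1-dimensional family = Hermite COORDINATES. For `[σ, xᵐ/√f]` there are `α, β ∈ ℚ` with
`xᵐ − (α + βx) ∈ D(ℚ[X])` (the coordinates, `hermiteDecomposition`, PROVED) and the representation is
congruent to the normal form `[σ, (α + βx)/√f]`: rule 1b once plus ONE exact form
`[σ, D(P)/√f] ∈ relations` (support item `HermiteExactFormVanishes`, rule 3 with the semialgebraic
primitive `P√f` vanishing at `e₃, e₂`). The 2-dimensional moments reduce to the same shape after one
rule-3 move along `y` (primitive `xᵃ y^{b+1}/(b+1)`), `b` odd giving instead a 0-dimensional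
constant `[pt, A]`, `A ∈ ℚ(e₂, e₃)`. [KontsevichZagier2001 §1.2; BostanLairezSalvy2013; Masser1975] -/
theorem stub_reduceOneDim (q₂ q₃ : ℚ) (hΔ : 0 < (q₂ : ℝ) ^ 3 - 27 * (q₃ : ℝ) ^ 2) (m : ℕ)
    (r : KZ.IntegralRep 1) (hr : r.domain = oval q₂ q₃)
    (hri : EqOn r.integrand (fun p => p 0 ^ m / Real.sqrt (cubic q₂ q₃ (p 0))) (oval q₂ q₃)) :
    ∃ (α β : ℚ) (P : ℚ[X]) (s : KZ.IntegralRep 1),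
      (Polynomial.X : ℚ[X]) ^ m = Polynomial.C α + Polynomial.C β * Polynomial.X + hermiteOp q₂ q₃ P ∧
      s.domain = oval q₂ q₃ ∧
      EqOn s.integrand (fun p => ((α : ℝ) + (β : ℝ) * p 0) / Real.sqrt (cubic q₂ q₃ (p 0))) (oval q₂ q₃) ∧
      KZ.of r - KZ.of s ∈ KZ.relations := by
  sorry

/-- The two transcendental normal forms exist as representations (stub; the only improper-integrability
fact of the line: `1/√f, x/√f ∈ L¹(e₃, e₂)`, simple roots — or read off the PROVED tree value
`∫_σ dx/√f = Ω₀/2 ≠ 0`, `PeriodPair.IsReal.integral_inv_sqrt_cubic_of_discr_pos_eq`). They carry the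
homomorphism `ν` (`α ↦ ⟦b₀.constMul α⟧`, `β ↦ ⟦b₁.constMul β⟧`, `KZ.IntegralRep.constMul`). -/
theorem stub_basisReps (q₂ q₃ : ℚ) (hΔ : 0 < (q₂ : ℝ) ^ 3 - 27 * (q₃ : ℝ) ^ 2) :
    ∃ b₀ b₁ : KZ.IntegralRep 1, b₀.domain = oval q₂ q₃ ∧ b₁.domain = oval q₂ q₃ ∧
      (b₀.integrand = fun p => 1 / Real.sqrt (cubic q₂ q₃ (p 0))) ∧
      (b₁.integrand = fun p => p 0 / Real.sqrt (cubic q₂ q₃ (p 0))) := by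
  sorry

/-! ## Card `merge-first-single-hermite` -/

/-- **First checkable statement of the line `merge-first-single-hermite`** (stub): MERGE TO A PAIR.
Every element of the sector is congruent, modulo relations, to ONE elliptic representation
`[σ, Q₁(x)/√f]` plus ONE polynomial moment representation `[D, Q₂(x, y)]` with `Q₁ ∈ ℚ[X]`,
`Q₂ ∈ ℚ[X, Y]` — closure induction in which the only move is rule 1b on a common domain
(`KZ.of_sub_of_mem_relations_of_eqOn`, `of_add_of_mem_relations_of_eqOn_neg`) and every
integrability is INHERITED from the given generators (`IntegrableOn.add/neg`); the empty cases use the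
zero representations on `σ`, `D` (`KZ.exists_zeroRep`). [KontsevichZagier2001 §1.2 rule 1)] -/
theorem stub_mergeToPair (q₂ q₃ : ℚ) (hΔ : 0 < (q₂ : ℝ) ^ 3 - 27 * (q₃ : ℝ) ^ 2) :
    ∀ c ∈ AddSubgroup.closure (gens q₂ q₃),
      ∃ (Q₁ : ℚ[X]) (Q₂ : MvPolynomial (Fin 2) ℚ) (r₁ : KZ.IntegralRep 1) (r₂ : KZ.IntegralRep 2),
        r₁.domain = oval q₂ q₃ ∧
        EqOn r₁.integrand
          (fun p => (Polynomial.aeval (p 0) Q₁ : ℝ) / Real.sqrt (cubic q₂ q₃ (p 0))) (oval q₂ q₃) ∧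
        r₂.domain = underGraph q₂ q₃ ∧
        EqOn r₂.integrand (fun p => (MvPolynomial.aeval p Q₂ : ℝ)) (underGraph q₂ q₃) ∧
        c - KZ.of r₁ - KZ.of r₂ ∈ KZ.relations := by
  sorry

/-- **The single column move** (stub): ONE Newton–Leibniz move along `y` (KZ rule 3 over the base `σ`,
band `0 ≤ y ≤ √f(x)`, POLYNOMIAL primitive `F(x, y) = ∫₀ʸ Q₂(x, t) dt`) turns the merged moment
representation into `[σ, G₀(x) + G₁(x)·√f(x)]` with `G₀, G₁ ∈ ℚ[X]` (odd powers of `y` give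
`c_b f^{(b+1)/2}/(b+1) ∈ ℚ[X]`, even powers give `c_b f^{b/2}·√f/(b+1)`); the passage between the open
`D` and the closed band is two null graphs (`KZ.of_sub_of_restrict_mem_relations`,
`KZ.of_mem_relations_of_volume_eq_zero`). -/
theorem stub_columnMove (q₂ q₃ : ℚ) (hΔ : 0 < (q₂ : ℝ) ^ 3 - 27 * (q₃ : ℝ) ^ 2)
    (Q₂ : MvPolynomial (Fin 2) ℚ) (r₂ : KZ.IntegralRep 2) (hd : r₂.domain = underGraph q₂ q₃)
    (hi : EqOn r₂.integrand (fun p => (MvPolynomial.aeval p Q₂ : ℝ)) (underGraph q₂ q₃)) :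
    ∃ (G₀ G₁ : ℚ[X]) (s : KZ.IntegralRep 1), s.domain = oval q₂ q₃ ∧
      EqOn s.integrand (fun p => (Polynomial.aeval (p 0) G₀ : ℝ) +
        (Polynomial.aeval (p 0) G₁ : ℝ) * Real.sqrt (cubic q₂ q₃ (p 0))) (oval q₂ q₃) ∧
      KZ.of r₂ - KZ.of s ∈ KZ.relations ∧
      s.value = (∫ p in oval q₂ q₃, (Polynomial.aeval (p 0) G₀ : ℝ)) +
        ∫ p in oval q₂ q₃, (Polynomial.aeval (p 0) (G₁ * (4 * Polynomial.X ^ 3 -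
          Polynomial.C q₂ * Polynomial.X - Polynomial.C q₃)) : ℝ) / Real.sqrt (cubic q₂ q₃ (p 0)) := by
  sorry

/-- END GAME of `merge-first-single-hermite` in one line of algebra (PROVED): after merging and the
column move the element is `[σ, Q/√f] + [σ, G₀]` with `Q = Q₁ + G₁·f`; write `Q = α + βx + D(P)`;
its value is `A + αJ₀ + βJ₁` with `A = ∫_σ G₀` algebraic, so rigidity forces `α = β = 0` — i.e.
`Q = D(P)` is EXACT — and `A = 0`; the two summands are then single exact forms
(`HermiteExactFormVanishes` for `D(P)/√f`; its polynomial sibling for `G₀` with `∫_σ G₀ = 0`). -/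
theorem endgame_exact (q₂ q₃ : ℚ) (hR : Rigid q₂ q₃) {Q P : ℚ[X]} {α β : ℚ} {A : ℝ}
    (hQ : Q = Polynomial.C α + Polynomial.C β * Polynomial.X + hermiteOp q₂ q₃ P)
    (hA : IsAlgebraic ℚ A)
    (hval : A + (α : ℝ) * (∫ p in oval q₂ q₃, 1 / Real.sqrt (cubic q₂ q₃ (p 0))) +
      (β : ℝ) * (∫ p in oval q₂ q₃, p 0 / Real.sqrt (cubic q₂ q₃ (p 0))) = 0) :
    Q = hermiteOp q₂ q₃ P ∧ A = 0 := by
  obtain ⟨h₁, h₂, h₃⟩ := rigid_coordinates q₂ q₃ hR A α β hA hval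
  subst h₂ h₃
  refine ⟨?_, h₁⟩
  simpa using hQ

end Summit.KontsevichZagierPeriods.KontsevichZagierPeriods.Cruxes.EllipticMomentKernel.Ideate1
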